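import Literature.NumberTheory.GaloisRepresentations.WeakAbelianDirectSummandTwistProofs
import Literature.NumberTheory.GaloisRepresentations.WeakAbelianDirectSummandCyclotomicProofs
import HarnessLib

/-!
# Weak abelian direct summands: characters with `ψ^M = χ_ℓ^{Md}` come from algebraic Hecke characters (proved)

Topic `NumberTheory/GaloisRepresentations`; namespace
`Literature.NumberTheory.GaloisRepresentations`.  A *proofs* file (theorems only; no definition,
no named fact, no instance), sibling of `WeakAbelianDirectSummand.lean` (Böckle–Hui 2025, Thm. 1.1;
named fact `exists_heckeCharacter_of_weaklyDivides`).

**Theorem** (`FramedGaloisRep.exists_heckeCharacter_of_pow_eq_cyclotomic_pow`).  Let `K` be a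
number field, `ℓ` a prime and `ψ : Γ_K →ₜ* GL_1(ℚ̄_ℓ)` a character with `ψ(σ)^M = χ_ℓ(σ)^{M d}`
for all `σ` (`M ≥ 1`, `d ∈ ℤ`, `χ_ℓ` the cyclotomic character).  Then `ψ` *comes from an algebraic
Hecke character* in the sense of the conclusion of `exists_heckeCharacter_of_weaklyDivides`: for
every `ι : ℚ̄_ℓ ≃ ℂ` there is an algebraic Hecke character `χ` with
`ψ(Frob_v) = ι⁻¹(χ(ϖ_v))⁻¹` at almost all `v` (namely `χ = ‖·‖^d ω` with `ω` of finite order).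

Indeed `ψ = ε · χ_ℓ^d` with `ε^M = 1`; `ε` has finite image, hence open kernel, and comes from a
finite-order Hecke character (`exists_heckeCharacter_eventually_of_isOpen_ker`, Artin
reciprocity); `χ_ℓ^d` comes from `‖·‖^{d}` (`exists_heckeCharacter_of_cyclotomic` and the closure
of the conclusion under products and inverses, `exists_heckeCharacter_of_entry_mul`,
`exists_heckeCharacter_of_entry_inv`).  This is the last step of BH's proof of Thm. 1.1 (§2.7 with
§2.4 "(Loc-alg) ⇒ (E-SCS)": a locally algebraic character is an algebraic Hecke character) in the
case where the algebraic part is a power of the cyclotomic character — over `K = ℚ` this is the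
general case (Serre, Ch. III §1.2: the algebraic characters of `𝔾_m` are `x ↦ x^d`).  Combined with
`WeaklyDivides.exists_pow_eq_cyclotomic_pow_rat` (`ψ^M = χ_ℓ^c` for a weak abelian direct summand
over `ℚ`), it reduces Thm. 1.1 over `ℚ` to the divisibility `M ∣ c`, i.e. to BH's Step 3 (density
zero of the exceptional set, Prop. 2.11).

## References

* G. Böckle, C.-Y. Hui, Math. Ann. 393 (2025), §2.4, §2.7. [BockleHui2025]
* J.-P. Serre, *Abelian ℓ-adic representations and elliptic curves* (1968), Ch. III §1.2, §2.
  [SerreAbelianLadic1968]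
-/

noncomputable section

open scoped NumberField Polynomial Topology
open NumberField IsDedekindDomain IsDedekindDomain.HeightOneSpectrum Field Polynomial Filter

namespace Literature.NumberTheory.GaloisRepresentations

namespace FramedGaloisRep

variable {K : Type} [Field K] {ℓ : ℕ} [Fact ℓ.Prime]

/-- A continuous character `χ : Γ_K →ₜ* Aˣ` is the entry of a rank-one framed representation
(`Aˣ ≃ GL_1(A)`). [folklore] -/
theorem exists_apply_eq_of_units {A : Type*} [CommRing A] [TopologicalSpace A]
    [IsTopologicalRing A] (χ : absoluteGaloisGroup K →ₜ* Aˣ) :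
    ∃ ψ : FramedGaloisRep K A 1, ∀ σ : absoluteGaloisGroup K,
      ((ψ σ : GL (Fin 1) A) : Matrix (Fin 1) (Fin 1) A) 0 0 = χ σ :=
  ⟨(FramedRep.unitsContinuousMulEquivOfUnique (Fin 1) A : Aˣ →ₜ* GL (Fin 1) A).comp χ,
    fun _ => rfl⟩

/-- Integer powers of a continuous character into the units, as a continuous character. [folklore] -/
theorem exists_continuousMonoidHom_apply_eq_zpow {A : Type*} [CommRing A] [TopologicalSpace A]
    [IsTopologicalRing A] (χ : absoluteGaloisGroup K →ₜ* Aˣ) (d : ℤ) :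
    ∃ χ' : absoluteGaloisGroup K →ₜ* Aˣ, ∀ σ, χ' σ = χ σ ^ d :=
  ⟨⟨{ toFun := fun σ => χ σ ^ d
      map_one' := by rw [map_one, one_zpow]
      map_mul' := fun a b => by rw [map_mul, mul_zpow] }, χ.continuous.zpow d⟩, fun _ => rfl⟩

/-- For a rank-one framed representation, `det (ψ σ) = ψ(σ)₀₀` (local copy of
`coe_det_apply_of_rank_one`). [folklore] -/
private theorem coe_det_apply_aux {A : Type*} [CommRing A] [TopologicalSpace A]
    [IsTopologicalRing A] (ψ : FramedGaloisRep K A 1) (σ : absoluteGaloisGroup K) :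
    ((FramedRep.det ψ σ : Aˣ) : A) = ((ψ σ : GL (Fin 1) A) : Matrix (Fin 1) (Fin 1) A) 0 0 := by
  rw [FramedRep.det_apply, Matrix.GeneralLinearGroup.val_det_apply, Matrix.det_fin_one]

/-- **A character killed by `M` has open kernel**: if `ψ(σ)^M = 1` for all `σ` (`M ≥ 1`) then
`ker ψ` is open — the values lie among the finitely many `M`-th roots of unity, a discrete set.
[folklore] -/
theorem isOpen_ker_of_pow_eq_one (ψ : FramedGaloisRep K (PadicAlgCl ℓ) 1) {M : ℕ} (hM : 0 < M)
    (hψ : ∀ σ : absoluteGaloisGroup K,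
      (((ψ σ : GL (Fin 1) (PadicAlgCl ℓ)) : Matrix (Fin 1) (Fin 1) (PadicAlgCl ℓ)) 0 0) ^ M = 1) :
    IsOpen (ψ.toMonoidHom.ker : Set (absoluteGaloisGroup K)) := by
  classical
  set f : absoluteGaloisGroup K → PadicAlgCl ℓ := fun σ =>
    ((ψ σ : GL (Fin 1) (PadicAlgCl ℓ)) : Matrix (Fin 1) (Fin 1) (PadicAlgCl ℓ)) 0 0 with hf
  have hfc : Continuous f := (Units.continuous_val.comp ψ.continuous).matrix_elem 0 0
  set S : Set (PadicAlgCl ℓ) := {z | z ^ M = 1 ∧ z ≠ 1} with hS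
  have hSfin : S.Finite := by
    refine (Multiset.finite_toSet (Polynomial.nthRoots M (1 : PadicAlgCl ℓ))).subset
      fun z hz => ?_
    simp only [Set.mem_setOf_eq] at hz ⊢
    exact (Polynomial.mem_nthRoots hM).mpr hz.1
  have hker : (ψ.toMonoidHom.ker : Set (absoluteGaloisGroup K)) = f ⁻¹' Sᶜ := by
    ext σ
    simp only [SetLike.mem_coe, MonoidHom.mem_ker, Set.mem_preimage, Set.mem_compl_iff, hS,
      Set.mem_setOf_eq, not_and, not_not]
    constructor
    · intro h1 _
      change ((ψ σ : GL (Fin 1) (PadicAlgCl ℓ)) : Matrix (Fin 1) (Fin 1) (PadicAlgCl ℓ)) 0 0 = 1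
      rw [show ψ σ = 1 from h1]
      rfl
    · intro h1
      exact gl_one_eq_one_of_apply_eq_one (h1 (hψ σ))
  rw [hker]
  exact hSfin.isClosed.isOpen_compl.preimage hfc

/-- **Characters with `ψ^M = χ_ℓ^{Md}` come from algebraic Hecke characters.**  For
`ψ : Γ_K →ₜ* GL_1(ℚ̄_ℓ)` with `ψ(σ)^M = χ_ℓ(σ)^{M d}` for all `σ` (`M ≥ 1`, `d ∈ ℤ`) and every
`ι : ℚ̄_ℓ ≃ ℂ`, there is an algebraic Hecke character `χ` of `K` with
`ψ(Frob_v) = ι⁻¹(χ(ϖ_v))⁻¹` (`ψ.HasFrobCharpolyAt v (X - C (ι⁻¹ (χ(ϖ_v))⁻¹))`) at all but finitely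
many `v` — the conclusion of `exists_heckeCharacter_of_weaklyDivides` for `ψ`.
[cite: BockleHui2025, §2.4 ((Loc-alg) ⇒ (E-SCS)) and §2.7] [cite: SerreAbelianLadic1968, Ch. III §1.2] -/
theorem exists_heckeCharacter_of_pow_eq_cyclotomic_pow [NumberField K]
    (ψ : FramedGaloisRep K (PadicAlgCl ℓ) 1) {M : ℕ} (hM : 0 < M) (d : ℤ)
    (hψ : ∀ σ : absoluteGaloisGroup K,
      (((ψ σ : GL (Fin 1) (PadicAlgCl ℓ)) : Matrix (Fin 1) (Fin 1) (PadicAlgCl ℓ)) 0 0) ^ M =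
        (algebraMap ℚ_[ℓ] (PadicAlgCl ℓ)
          (((GaloisRep.cyclotomicCharacter K ℓ σ : ℤ_[ℓ]ˣ) : ℤ_[ℓ]) : ℚ_[ℓ])) ^ ((M : ℤ) * d))
    (ι : PadicAlgCl ℓ ≃+* ℂ) :
    ∃ χ : HeckeCharacter K, χ.IsAlgebraic ∧
      ∀ᶠ v : HeightOneSpectrum (𝓞 K) in cofinite, χ.IsUnramifiedAt v ∧ ψ.IsUnramifiedAt v ∧
        ψ.HasFrobCharpolyAt v (X - C (ι.symm (χ.valueAtUniformizer v)⁻¹)) := by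
  -- the `ℚ̄_ℓ`-valued cyclotomic character `cyc` with entry `c(σ)`
  obtain ⟨cyc, hcyc⟩ := exists_cyclotomic_padicAlgCl K ℓ
  set c : absoluteGaloisGroup K → PadicAlgCl ℓ := fun σ =>
    algebraMap ℚ_[ℓ] (PadicAlgCl ℓ) (((GaloisRep.cyclotomicCharacter K ℓ σ : ℤ_[ℓ]ˣ) : ℤ_[ℓ]) :
      ℚ_[ℓ]) with hc
  have hc0 : ∀ σ, c σ ≠ 0 := fun σ => by
    rw [hc, map_ne_zero_iff _ (algebraMap ℚ_[ℓ] (PadicAlgCl ℓ)).injective, ne_eq,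
      PadicInt.coe_eq_zero]
    exact (GaloisRep.cyclotomicCharacter K ℓ σ).ne_zero
  have hdet : ∀ σ, ((FramedRep.det cyc σ : (PadicAlgCl ℓ)ˣ) : PadicAlgCl ℓ) = c σ := fun σ => by
    rw [coe_det_apply_aux, hcyc σ]
  -- the powers `φ e` with entry `c(σ)^e`
  have hpow : ∀ e : ℤ, ∃ φ : FramedGaloisRep K (PadicAlgCl ℓ) 1, ∀ σ,
      ((φ σ : GL (Fin 1) (PadicAlgCl ℓ)) : Matrix (Fin 1) (Fin 1) (PadicAlgCl ℓ)) 0 0 =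
        c σ ^ e := by
    intro e
    obtain ⟨χ', hχ'⟩ := exists_continuousMonoidHom_apply_eq_zpow (FramedRep.det cyc) e
    obtain ⟨φ, hφ⟩ := exists_apply_eq_of_units χ'
    exact ⟨φ, fun σ => by rw [hφ, hχ', Units.val_zpow_eq_zpow_val, hdet]⟩
  choose φ hφ using hpow
  -- the conclusion for `φ e`, by induction on `e`
  have hconcl : ∀ e : ℤ, ∃ χ : HeckeCharacter K, χ.IsAlgebraic ∧
      ∀ᶠ v : HeightOneSpectrum (𝓞 K) in cofinite, χ.IsUnramifiedAt v ∧ (φ e).IsUnramifiedAt v ∧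
        (φ e).HasFrobCharpolyAt v (X - C (ι.symm (χ.valueAtUniformizer v)⁻¹)) := by
    intro e
    induction e using Int.induction_on with
    | zero =>
      -- `φ 0` is trivial
      have hker : IsOpen ((φ 0).toMonoidHom.ker : Set (absoluteGaloisGroup K)) :=
        isOpen_ker_of_pow_eq_one (φ 0) one_pos fun σ => by rw [hφ, zpow_zero, one_pow]
      obtain ⟨χ, halg, -, hχ⟩ := (φ 0).exists_heckeCharacter_eventually_of_isOpen_ker hker ι
      exact ⟨χ, halg, hχ⟩
    | succ i ih =>
      refine exists_heckeCharacter_of_entry_mul (φ ((i : ℤ) + 1)) (φ i) cyc (fun σ => ?_) ι ih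
        (exists_heckeCharacter_of_cyclotomic cyc hcyc ι)
      rw [hφ, hφ, hcyc σ, zpow_add_one₀ (hc0 σ)]
    | pred i ih =>
      -- the inverse of `cyc`
      have hinv := exists_heckeCharacter_of_entry_inv (φ (-1)) cyc (fun σ => by
        rw [hφ, hcyc σ, zpow_neg_one]) ι (exists_heckeCharacter_of_cyclotomic cyc hcyc ι)
      refine exists_heckeCharacter_of_entry_mul (φ (-(i : ℤ) - 1)) (φ (-(i : ℤ))) (φ (-1))
        (fun σ => ?_) ι ih hinv
      rw [hφ, hφ, hφ, zpow_sub_one₀ (hc0 σ), zpow_neg_one]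
  -- the finite-order part `ε = ψ · c^{-d}`
  obtain ⟨εu, hεu⟩ : ∃ εu : absoluteGaloisGroup K →ₜ* (PadicAlgCl ℓ)ˣ, ∀ σ,
      εu σ = FramedRep.det ψ σ * FramedRep.det cyc σ ^ (-d) :=
    ⟨⟨{ toFun := fun σ => FramedRep.det ψ σ * FramedRep.det cyc σ ^ (-d)
        map_one' := by rw [map_one, map_one, one_zpow, mul_one]
        map_mul' := fun a b => by rw [map_mul, map_mul, mul_zpow, mul_mul_mul_comm] },
      (FramedRep.det ψ).continuous.mul ((FramedRep.det cyc).continuous.zpow _)⟩, fun _ => rfl⟩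
  obtain ⟨ε, hε⟩ := exists_apply_eq_of_units εu
  have hεval : ∀ σ, ((ε σ : GL (Fin 1) (PadicAlgCl ℓ)) : Matrix (Fin 1) (Fin 1) (PadicAlgCl ℓ)) 0 0 =
      (((ψ σ : GL (Fin 1) (PadicAlgCl ℓ)) : Matrix (Fin 1) (Fin 1) (PadicAlgCl ℓ)) 0 0) *
        c σ ^ (-d) := fun σ => by
    rw [hε, hεu, Units.val_mul, Units.val_zpow_eq_zpow_val, coe_det_apply_aux, hdet]
  -- `ε^M = 1`
  have hεM : ∀ σ, (((ε σ : GL (Fin 1) (PadicAlgCl ℓ)) :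
      Matrix (Fin 1) (Fin 1) (PadicAlgCl ℓ)) 0 0) ^ M = 1 := fun σ => by
    rw [hεval, mul_pow, hψ σ, ← zpow_natCast (c σ ^ (-d)), ← zpow_mul, ← zpow_add₀ (hc0 σ)]
    convert zpow_zero (c σ) using 2
    ring
  have hkerε : IsOpen (ε.toMonoidHom.ker : Set (absoluteGaloisGroup K)) :=
    isOpen_ker_of_pow_eq_one ε hM hεM
  obtain ⟨χε, hχεalg, -, hχε⟩ := ε.exists_heckeCharacter_eventually_of_isOpen_ker hkerε ι
  -- `ψ = ε · φ d`
  refine exists_heckeCharacter_of_entry_mul ψ ε (φ d) (fun σ => ?_) ι ⟨χε, hχεalg, hχε⟩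
    (hconcl d)
  rw [hεval, hφ, mul_assoc, ← zpow_add₀ (hc0 σ), neg_add_cancel, zpow_zero, mul_one]

end FramedGaloisRep

end Literature.NumberTheory.GaloisRepresentations

end
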